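import Mathlib
import HarnessLib
import Summits.NavierStokesRegularity.NavierStokesRegularity.Theorems.UnthreadedDoorNetFluxDefs

/-!
# Route `UnthreadedDoor`, crux `PoloidalLiouville` (stmt-NavierStokesRegularity-1222), WALL W1 — crux idea «kinematic-shadow» (ns-idea-15),
# zonal sub-rung A_z tooling: FIRST-ORDER CALCULUS OF THE ZONAL COORDINATE `c(x) = ⟪x − x₀, e⟫ / ‖x − x₀‖`

Stage 1a of ARM A g5's A_z plan (`HomogeneousZonalToroidalNeverSteady`, KinematicShadowSketch v1.2): for a unit vector `e` and `x ≠ x₀`,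
with `y = x − x₀`, `r = ‖y‖`:
* `hasFDerivAt_norm_sub` — `D‖· − x₀‖(x) = r⁻¹ ⟪y, ·⟫`;
* `hasFDerivAt_zonalCos` — `Dc(x) = r⁻¹ ⟪e, ·⟫ − (⟪y,e⟫ r⁻³) ⟪y, ·⟫`, `hasGradientAt_zonalCos` — `∇c(x) = r⁻¹ • e − (⟪y,e⟫ r⁻³) • y`;
* `zonalCos_smul` — 0-homogeneity `c(x₀ + s • y) = c(x)` (`s > 0`); `inner_gradient_zonalCos_self` — `⟪∇c(x), y⟫ = 0`;
* `contDiffOn_zonalCos` — `c` is `C^∞` on `{x₀}ᶜ`; `abs_zonalCos_le_one`.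
Pure calculus in a real inner product space (stated on `EuclideanSpace ℝ (Fin 3)`); nothing here is an NS statement; 1222 / W1 / NS regularity OPEN.
`--supports stmt-NavierStokesRegularity-1222 --as helper`.
-/

noncomputable section

-- the summit and its single sub-problem share the name (CONVENTIONS §1)
set_option linter.dupNamespace false

open Set Function Filter Topology InnerProductSpace
open scoped RealInnerProductSpace

namespace Summit.NavierStokesRegularity.NavierStokesRegularity.Theorems.PoloidalLiouville.KinematicShadow

open Summit.NavierStokesRegularity.NavierStokesRegularity.Theorems.PoloidalLiouville.NetFlux (E3)

/-- `D‖· − x₀‖(x) v = ⟪x − x₀, v⟫ / ‖x − x₀‖` at `x ≠ x₀`. [folklore] -/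
theorem hasFDerivAt_norm_sub {x₀ x : E3} (hx : x ≠ x₀) :
    HasFDerivAt (fun z : E3 => ‖z - x₀‖) (‖x - x₀‖⁻¹ • innerSL ℝ (x - x₀)) x := by
  have hr : 0 < ‖x - x₀‖ := norm_pos_iff.2 (sub_ne_zero.2 hx)
  have h1 : HasFDerivAt (fun z : E3 => ‖z - x₀‖ ^ 2) (2 • (innerSL ℝ (x - x₀)).comp (ContinuousLinearMap.id ℝ E3)) x :=
    ((hasFDerivAt_id x).sub_const x₀).norm_sq
  have h2 : HasDerivAt Real.sqrt (1 / (2 * Real.sqrt (‖x - x₀‖ ^ 2))) (‖x - x₀‖ ^ 2) :=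
    Real.hasDerivAt_sqrt (pow_pos hr 2).ne'
  have h3 := h2.comp_hasFDerivAt x h1
  have hsq : Real.sqrt (‖x - x₀‖ ^ 2) = ‖x - x₀‖ := Real.sqrt_sq hr.le
  have h4 : HasFDerivAt (fun z : E3 => ‖z - x₀‖)
      ((1 / (2 * Real.sqrt (‖x - x₀‖ ^ 2))) • (2 • (innerSL ℝ (x - x₀)).comp (ContinuousLinearMap.id ℝ E3))) x :=
    h3.congr_of_eventuallyEq (Eventually.of_forall fun z => (Real.sqrt_sq (norm_nonneg (z - x₀))).symm)
  refine h4.congr_fderiv ?_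
  ext v
  rw [hsq]
  simp
  field_simp

/-- 0-homogeneity of the zonal coordinate: `c(x₀ + s • (x − x₀)) = c(x)` for `s > 0`. [folklore] -/
theorem zonalCos_smul (x₀ e x : E3) {s : ℝ} (hs : 0 < s) :
    ⟪(x₀ + s • (x - x₀)) - x₀, e⟫ / ‖(x₀ + s • (x - x₀)) - x₀‖ = ⟪x - x₀, e⟫ / ‖x - x₀‖ := by
  rw [add_sub_cancel_left, real_inner_smul_left, norm_smul, Real.norm_eq_abs, abs_of_pos hs]
  by_cases h : ‖x - x₀‖ = 0
  · simp [h]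
  · field_simp

/-- `|c(x)| ≤ 1` for a unit vector `e` (Cauchy–Schwarz). [folklore] -/
theorem abs_zonalCos_le_one (x₀ x : E3) {e : E3} (he : ‖e‖ = 1) : |⟪x - x₀, e⟫ / ‖x - x₀‖| ≤ 1 := by
  by_cases h : ‖x - x₀‖ = 0
  · simp [h]
  · rw [abs_div, abs_norm, div_le_one (lt_of_le_of_ne (norm_nonneg _) (Ne.symm h))]
    calc |⟪x - x₀, e⟫| ≤ ‖x - x₀‖ * ‖e‖ := abs_real_inner_le_norm _ _
      _ = ‖x - x₀‖ := by rw [he, mul_one]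

/-- The zonal coordinate is `C^∞` off the centre. [folklore] -/
theorem contDiffOn_zonalCos (x₀ e : E3) {n : WithTop ℕ∞} :
    ContDiffOn ℝ n (fun z : E3 => ⟪z - x₀, e⟫ / ‖z - x₀‖) ({x₀}ᶜ : Set E3) := by
  intro x hx
  have hx' : x - x₀ ≠ 0 := sub_ne_zero.2 hx
  refine ((contDiffAt_id.sub contDiffAt_const).inner ℝ contDiffAt_const).contDiffWithinAt.div
    ((contDiffAt_id.sub contDiffAt_const).norm ℝ hx').contDiffWithinAt (norm_ne_zero_iff.2 hx')

/-- **Derivative of the zonal coordinate**: `Dc(x) v = ⟪e, v⟫/r − ⟪y,e⟫ ⟪y, v⟫/r³` (`y = x − x₀`, `r = ‖y‖`, `x ≠ x₀`). [folklore] -/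
theorem hasFDerivAt_zonalCos {x₀ x : E3} (e : E3) (hx : x ≠ x₀) :
    HasFDerivAt (fun z : E3 => ⟪z - x₀, e⟫ / ‖z - x₀‖)
      (‖x - x₀‖⁻¹ • innerSL ℝ e - (⟪x - x₀, e⟫ * (‖x - x₀‖ ^ 3)⁻¹) • innerSL ℝ (x - x₀)) x := by
  have hr : 0 < ‖x - x₀‖ := norm_pos_iff.2 (sub_ne_zero.2 hx)
  have hnum : HasFDerivAt (fun z : E3 => ⟪z - x₀, e⟫) (innerSL ℝ e) x := by
    have h1 := ((hasFDerivAt_id x).sub_const x₀).inner ℝ (hasFDerivAt_const e x)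
    refine h1.congr_fderiv ?_
    ext v
    simp [fderivInnerCLM_apply, real_inner_comm]
  have hden := hasFDerivAt_norm_sub hx
  have hinv : HasFDerivAt (fun z : E3 => ‖z - x₀‖⁻¹) ((-(‖x - x₀‖ ^ 2)⁻¹) • (‖x - x₀‖⁻¹ • innerSL ℝ (x - x₀))) x :=
    (hasDerivAt_inv hr.ne').comp_hasFDerivAt x hden
  have h := hnum.mul hinv
  have heq : (fun z : E3 => ⟪z - x₀, e⟫ / ‖z - x₀‖) = fun z => ⟪z - x₀, e⟫ * ‖z - x₀‖⁻¹ := by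
    funext z; rw [div_eq_mul_inv]
  rw [heq]
  refine h.congr_fderiv ?_
  ext v
  simp
  field_simp
  ring

/-- **Gradient of the zonal coordinate**: `∇c(x) = r⁻¹ • e − (⟪y,e⟫ r⁻³) • y`. [folklore] -/
theorem hasGradientAt_zonalCos {x₀ x : E3} (e : E3) (hx : x ≠ x₀) :
    HasGradientAt (fun z : E3 => ⟪z - x₀, e⟫ / ‖z - x₀‖)
      (‖x - x₀‖⁻¹ • e - (⟪x - x₀, e⟫ * (‖x - x₀‖ ^ 3)⁻¹) • (x - x₀)) x := by
  have hL : toDual ℝ E3 (‖x - x₀‖⁻¹ • e - (⟪x - x₀, e⟫ * (‖x - x₀‖ ^ 3)⁻¹) • (x - x₀))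
      = ‖x - x₀‖⁻¹ • innerSL ℝ e - (⟪x - x₀, e⟫ * (‖x - x₀‖ ^ 3)⁻¹) • innerSL ℝ (x - x₀) := by
    ext v
    simp [inner_sub_left]
  rw [hasGradientAt_iff_hasFDerivAt, hL]
  exact hasFDerivAt_zonalCos e hx

/-- `∇c(x)` in closed form. [folklore] -/
theorem gradient_zonalCos {x₀ x : E3} (e : E3) (hx : x ≠ x₀) :
    gradient (fun z : E3 => ⟪z - x₀, e⟫ / ‖z - x₀‖) x
      = ‖x - x₀‖⁻¹ • e - (⟪x - x₀, e⟫ * (‖x - x₀‖ ^ 3)⁻¹) • (x - x₀) :=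
  (hasGradientAt_zonalCos e hx).gradient

/-- Algebra: `⟪r⁻¹ e − (⟪y,e⟫ r⁻³) y, y⟫ = 0` for `y ≠ 0`, `r = ‖y‖`. [folklore] -/
theorem inner_zonalGrad_self (e : E3) {y : E3} (hy : y ≠ 0) :
    ⟪‖y‖⁻¹ • e - (⟪y, e⟫ * (‖y‖ ^ 3)⁻¹) • y, y⟫ = 0 := by
  have hr : 0 < ‖y‖ := norm_pos_iff.2 hy
  rw [inner_sub_left, real_inner_smul_left, real_inner_smul_left, real_inner_self_eq_norm_sq, real_inner_comm y e]
  field_simp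
  ring

/-- Algebra: `‖r⁻¹ e − (⟪y,e⟫ r⁻³) y‖² = (1 − (⟪y,e⟫/r)²)/r²` for `y ≠ 0`, `‖e‖ = 1`. [folklore] -/
theorem norm_sq_zonalGrad {e : E3} (he : ‖e‖ = 1) {y : E3} (hy : y ≠ 0) :
    ‖‖y‖⁻¹ • e - (⟪y, e⟫ * (‖y‖ ^ 3)⁻¹) • y‖ ^ 2 = (1 - (⟪y, e⟫ / ‖y‖) ^ 2) / ‖y‖ ^ 2 := by
  have hr : 0 < ‖y‖ := norm_pos_iff.2 hy
  rw [norm_sub_sq_real, norm_smul, norm_smul, real_inner_smul_left, real_inner_smul_right, norm_inv, norm_norm, he,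
    Real.norm_eq_abs, real_inner_comm y e]
  have habs : (|⟪y, e⟫ * (‖y‖ ^ 3)⁻¹| * ‖y‖) ^ 2 = (⟪y, e⟫ * (‖y‖ ^ 3)⁻¹) ^ 2 * ‖y‖ ^ 2 := by
    rw [mul_pow, sq_abs]
  rw [habs]
  field_simp
  ring

/-- The gradient of the zonal coordinate is tangent to spheres about `x₀`: `⟪∇c(x), x − x₀⟫ = 0`. [folklore] -/
theorem inner_gradient_zonalCos_self {x₀ x : E3} (e : E3) (hx : x ≠ x₀) :
    ⟪gradient (fun z : E3 => ⟪z - x₀, e⟫ / ‖z - x₀‖) x, x - x₀⟫ = 0 := by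
  rw [gradient_zonalCos e hx]
  exact inner_zonalGrad_self e (sub_ne_zero.2 hx)

/-- `‖∇c(x)‖² = (1 − c(x)²)/r²` for a unit vector `e`. [folklore] -/
theorem norm_sq_gradient_zonalCos {x₀ x : E3} {e : E3} (he : ‖e‖ = 1) (hx : x ≠ x₀) :
    ‖gradient (fun z : E3 => ⟪z - x₀, e⟫ / ‖z - x₀‖) x‖ ^ 2
      = (1 - (⟪x - x₀, e⟫ / ‖x - x₀‖) ^ 2) / ‖x - x₀‖ ^ 2 := by
  rw [gradient_zonalCos e hx]
  exact norm_sq_zonalGrad he (sub_ne_zero.2 hx)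

end Summit.NavierStokesRegularity.NavierStokesRegularity.Theorems.PoloidalLiouville.KinematicShadow
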